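import Literature.NumberTheory.Automorphic.AdelicUnitaryGroupDatum
import Literature.NumberTheory.Automorphic.UnitaryGroupPoints
import Literature.NumberTheory.QuadraticForms.LandherrHermitianRealisation
import Mathlib.NumberTheory.Cyclotomic.PrimitiveRoots
import Mathlib.RingTheory.Polynomial.Cyclotomic.Roots
import HarnessLib

/-!
# Non-degeneracy witness for the Picard-modular unitary datum (sextic CM regime)

Topic `NumberTheory/Automorphic`; namespace `Literature.NumberTheory.Automorphic` (grouping sub-namespace
`UnitaryGroup`). **No named facts, no `sorry`**, imports = Mathlib + tree.

The unitary data consumed downstream ("a CM field `L`, a place `w₁ ∣ ∞`, a hermitian `H ∈ M₃(L)` of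
signature `(2,1)` at `w₁` and positive definite at every other place") are NOT vacuous, and land in the
compact regime, for EVERY CM field with `[L:ℚ] ≥ 4` and every `w₁` — in particular for the sextic CM
field `ℚ(ζ₇)`:

* `exists_picardDiagonal L w₁`: a diagonal hermitian `H = diag(a₁,a₂,a₃)`, `aᵢ ∈ L⁺ˣ`, of positive index
  `2` at `w₁` and `3` at every other infinite place (tree: Landherr realisation
  `Landherr.exists_hermitianDiagonal_of_invariants` + prescribed signs `exists_isReal_signs`);
* `posDef_map_diagonal_of_posCount`: positive index `= rank` at `τ` ⇒ `(diag a).map τ` positive definite;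
* `picardDiagonal_anisotropic`, `compactSpace_cmDatum_picardDiagonal`: for `[L:ℚ] ≥ 4` such an `H` is
  anisotropic and `[U(H)] = U(H)(L⁺)\U(H)(𝔸_{L⁺})` (`(cmDatum L 3 H).automorphicQuotient`) is COMPACT
  (`AdelicUnitaryGroupDatum`: definite at one place ⇒ anisotropic ⇒ Godement);
* `finrank_cyclotomicField_seven` (`[ℚ(ζ₇):ℚ] = 6`; `ℚ(ζ₇)` is CM: tree instance
  `isCMField_cyclotomicField_seven` of `UnitaryGroupPoints`) and `sextic_picard_witness`: a sextic CM field with a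
  Picard datum whose adelic unitary quotient is compact EXISTS.

## References

* P. Deligne, *Hodge cycles on abelian varieties*, LNM 900 (1982), §4 Prop. 4.1 p. 44 (realisation of
  hermitian invariants; tree theorem). [Deligne1982HodgeCycles]
* R. Godement, Sém. Bourbaki 257 (1962/63) Thm. 4.2 (compactness; tree theorem
  `Godement.compactSpace_adelicUnitaryQuot`).
-/

noncomputable section

open NumberField Module
open scoped ComplexOrder
open Literature.AlgebraicGeometry.ShimuraVarieties (hermForm)
open Literature.NumberTheory.QuadraticForms (Landherr.posCount)

namespace Literature.NumberTheory.Automorphic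

namespace UnitaryGroup

variable (L : Type) [Field L] [NumberField L] [IsCMField L]

/-- **Picard signature data exist**: for every infinite place `w₁` of a CM field there is a diagonal
hermitian `diag(a₁,a₂,a₃)`, `aᵢ ∈ L⁺ˣ`, of positive index `2` at `w₁` and `3` at every other place.
[folklore] -/
theorem exists_picardDiagonal (w₁ : InfinitePlace L) :
    ∃ a : Fin 3 → L, (∀ i, IsCMField.complexConj L (a i) = a i) ∧ (∀ i, a i ≠ 0) ∧
      ∀ τ : L →+* ℂ, (InfinitePlace.mk τ = w₁ → Landherr.posCount L τ a = 2) ∧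
        (InfinitePlace.mk τ ≠ w₁ → Landherr.posCount L τ a = 3) := by
  classical
  -- a discriminant negative exactly at `w₁`
  obtain ⟨f, hf, hfsign⟩ := NumberFields.exists_isReal_signs L fun w => decide (w ≠ w₁)
  obtain ⟨τ₀⟩ : Nonempty (L →+* ℂ) := inferInstance
  have hf0 : f ≠ 0 := by
    obtain ⟨r, hr, hr0, -⟩ := hfsign τ₀
    rintro rfl
    rw [map_zero] at hr
    exact hr0 (by exact_mod_cast hr.symm)
  obtain ⟨a, ha, ha0, hcount, -⟩ :=
    QuadraticForms.Landherr.exists_hermitianDiagonal_of_invariants L (n := 3) (by norm_num)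
      (fun w => if w = w₁ then 2 else 3) (fun w => by split_ifs <;> norm_num) hf hf0 (fun τ => by
        obtain ⟨r, hr, hr0, hiff⟩ := hfsign τ
        rw [hr, Complex.ofReal_re, hiff, decide_eq_true_iff]
        by_cases h : InfinitePlace.mk τ = w₁
        · simp [h]
        · simp [h])
  exact ⟨a, ha, ha0, fun τ => ⟨fun h => by rw [hcount, if_pos h], fun h => by rw [hcount, if_neg h]⟩⟩

variable {L} in
/-- Positive index `= rank` at `τ` for real diagonal entries ⇒ `(diag a).map τ` is positive definite.
[folklore] -/
theorem posDef_map_diagonal_of_posCount {n : ℕ} {a : Fin n → L}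
    (ha : ∀ i, IsCMField.complexConj L (a i) = a i) (τ : L →+* ℂ)
    (h : Landherr.posCount L τ a = n) : ((Matrix.diagonal a).map τ).PosDef := by
  classical
  have hall : ∀ i, 0 < (τ (a i)).re := by
    have huniv : (Finset.univ.filter fun i => 0 < (τ (a i)).re) = Finset.univ :=
      Finset.eq_univ_of_card _ (by
        rw [Fintype.card_fin]
        exact h)
    intro i
    have hi := Finset.mem_univ i
    rw [← huniv, Finset.mem_filter] at hi
    exact hi.2
  rw [Matrix.diagonal_map (map_zero τ), Matrix.posDef_diagonal_iff]
  intro i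
  rw [QuadraticForms.Landherr.embedding_eq_re (ha i) τ]
  exact Complex.zero_lt_real.mpr (hall i)

variable {L} in
/-- A Picard diagonal is ANISOTROPIC as soon as `L` has a second infinite place (`[L:ℚ] ≥ 4`): it is
definite there. [folklore] -/
theorem picardDiagonal_anisotropic (h4 : 4 ≤ finrank ℚ L) (w₁ : InfinitePlace L) {a : Fin 3 → L}
    (ha : ∀ i, IsCMField.complexConj L (a i) = a i)
    (hcount : ∀ τ : L →+* ℂ, (InfinitePlace.mk τ = w₁ → Landherr.posCount L τ a = 2) ∧
        (InfinitePlace.mk τ ≠ w₁ → Landherr.posCount L τ a = 3)) :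
    ∀ x : Fin 3 → L, hermForm (cmConjRingHom L) (Matrix.diagonal a) x x = 0 → x = 0 := by
  obtain ⟨τ, hτ⟩ := exists_infinitePlace_ne L h4 w₁.embedding
  rw [InfinitePlace.mk_embedding] at hτ
  exact anisotropic_of_posDef_map L (Matrix.diagonal a) τ
    (posDef_map_diagonal_of_posCount ha τ ((hcount τ).2 hτ))

variable {L} in
/-- **Compactness in the Picard regime**: for a Picard diagonal over a CM field with `[L:ℚ] ≥ 4` the
automorphic quotient `U(H)(L⁺)\U(H)(𝔸_{L⁺})` of `cmDatum L 3 H` is compact. [folklore] -/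
theorem compactSpace_cmDatum_picardDiagonal (h4 : 4 ≤ finrank ℚ L) (w₁ : InfinitePlace L)
    {a : Fin 3 → L} (ha : ∀ i, IsCMField.complexConj L (a i) = a i)
    (hcount : ∀ τ : L →+* ℂ, (InfinitePlace.mk τ = w₁ → Landherr.posCount L τ a = 2) ∧
        (InfinitePlace.mk τ ≠ w₁ → Landherr.posCount L τ a = 3)) :
    CompactSpace (cmDatum L 3 (Matrix.diagonal a)).automorphicQuotient :=
  compactSpace_cmDatum_automorphicQuotient L 3 (Matrix.diagonal a)
    (picardDiagonal_anisotropic h4 w₁ ha hcount)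

/-- **Every CM field with `[L:ℚ] ≥ 4` carries a compact Picard unitary datum** at every infinite place.
[folklore] -/
theorem exists_compact_picardDatum (h4 : 4 ≤ finrank ℚ L) (w₁ : InfinitePlace L) :
    ∃ a : Fin 3 → L, (∀ i, IsCMField.complexConj L (a i) = a i) ∧ (∀ i, a i ≠ 0) ∧
      (∀ τ : L →+* ℂ, (InfinitePlace.mk τ = w₁ → Landherr.posCount L τ a = 2) ∧
        (InfinitePlace.mk τ ≠ w₁ → Landherr.posCount L τ a = 3)) ∧
      (∀ x : Fin 3 → L, hermForm (cmConjRingHom L) (Matrix.diagonal a) x x = 0 → x = 0) ∧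
      CompactSpace (cmDatum L 3 (Matrix.diagonal a)).automorphicQuotient := by
  obtain ⟨a, ha, ha0, hcount⟩ := exists_picardDiagonal L w₁
  exact ⟨a, ha, ha0, hcount, picardDiagonal_anisotropic h4 w₁ ha hcount,
    compactSpace_cmDatum_picardDiagonal h4 w₁ ha hcount⟩

/-! ### The sextic CM field `ℚ(ζ₇)` -/

/-- `[ℚ(ζ₇) : ℚ] = 6`. [folklore] -/
theorem finrank_cyclotomicField_seven : finrank ℚ (CyclotomicField.{0} 7 ℚ) = 6 := by
  haveI : IsCyclotomicExtension {7} ℚ (CyclotomicField.{0} 7 ℚ) :=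
    CyclotomicField.instIsCyclotomicExtensionSingletonNatSetOfCharZero 7 ℚ
  rw [IsCyclotomicExtension.finrank (n := 7) (K := ℚ) (CyclotomicField.{0} 7 ℚ)
    (Polynomial.cyclotomic.irreducible_rat (by norm_num)), Nat.totient_prime (by norm_num)]

/-- **Sextic witness.** There are a CM field of degree `6` (namely `ℚ(ζ₇)`), an infinite place `w₁`,
and a diagonal hermitian `H ∈ M₃` of signature `(2,1)` at `w₁` and definite at the other two places,
anisotropic, with compact adelic unitary quotient `[U(H)]`. [folklore] -/
theorem sextic_picard_witness :
    finrank ℚ (CyclotomicField.{0} 7 ℚ) = 6 ∧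
    ∀ w₁ : InfinitePlace (CyclotomicField.{0} 7 ℚ),
      ∃ a : Fin 3 → CyclotomicField.{0} 7 ℚ,
        (∀ i, IsCMField.complexConj _ (a i) = a i) ∧ (∀ i, a i ≠ 0) ∧
        (∀ τ : CyclotomicField.{0} 7 ℚ →+* ℂ,
          (InfinitePlace.mk τ = w₁ → Landherr.posCount _ τ a = 2) ∧
          (InfinitePlace.mk τ ≠ w₁ → Landherr.posCount _ τ a = 3)) ∧
        (∀ x, hermForm (cmConjRingHom _) (Matrix.diagonal a) x x = 0 → x = 0) ∧
        CompactSpace (cmDatum (CyclotomicField.{0} 7 ℚ) 3 (Matrix.diagonal a)).automorphicQuotient :=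
  ⟨finrank_cyclotomicField_seven, fun w₁ =>
    exists_compact_picardDatum _ (by rw [finrank_cyclotomicField_seven]; norm_num) w₁⟩

end UnitaryGroup

end Literature.NumberTheory.Automorphic

end
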